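import Mathlib
import Summits.Ventures.HodgeRepro2.Tier7.Line3.LevelInvariantOrbital
import Summits.Ventures.HodgeRepro2.Tier7.Line3.LevelFactorPositive
import Summits.Ventures.HodgeRepro2.Tier7.Line3.LevelFactorData

/-!
# Tier7/Line3/LevelFactorOfLocal — `LevelFactorData` from the three local facts at `v₁` (the `bv_γ₀` field discharged)
(seat t7-x1, gen 3; the bridge module announced at STATUS l. 15677)

Two things: (1) the rfl-bridge — LevelFactorPositive's twisted level integrand IS LevelInvariantOrbital's
`orbital μA μB ιA ιB χA ψB ((coset γ₀ K).indicator 1) γ₀` (`levelFactor_eq_orbital`); (2) `LevelFactorData.ofLocal`: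
a `LevelFactorData` whose only non-displayed field, `bv_γ₀` («the level factor at `γ₀` is non-zero for `N ≥ N₀`»), is
DISCHARGED from LevelFactorPositive p691647's three local facts — the characters LOCALLY CONSTANT, the CENTRAL MATCH on
the stabiliser, the levels OPEN, decreasing, `⋂ K_N = {1}` — on compact `A`, `B` with finite open-positive Haar measures.
Hence (`LevelFactorData.kappaData_b_fields`) the three `b`-fields of `KappaData` (`b_support`, `b_bound`, `b_γ₀`) hold for
`b N γ = bS γ · bv N γ` with the level factor `bv` DEFINED as the twisted orbital integral of `1_{γ₀ K_N}` at a local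
representative, from: the displayed clauses of the `N`-independent part `bS` (the places `≠ v₁`), the normalisation
`T_B(F_{v₁}) ⊂ K₁ ⊳ K_N`, and the three local facts at `v₁` — `ofLocal_kappaData_b_fields`.
DICTIONARY (in words, [M]-level, not distance to (P); TYPING-CENSUS T7): as in the three imported modules (the stabiliser
of the regular `γ₀` = the diagonal centre for injective `ι_A`, `ι_B`; (C) on it; `v₁` inert; `loc` = the `v₁`-component).
Nothing here is about (N), (P), the real `X`, or HC_CM; §8(d): NO. Blind lane: Mathlib + the HodgeRepro2 prefix; no sorry;
axioms ⊆ {propext, Classical.choice, Quot.sound}.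
-/

namespace Summit.Ventures.HodgeRepro2.Tier7.Line3.LevelFactor

open MeasureTheory LevelInvariantOrbital

section Bridge

variable {A B G : Type*} [Group A] [Group B] [Group G] [MeasurableSpace A] [MeasurableSpace B]
  (μA : Measure A) (μB : Measure B)

/-- **the rfl-bridge**: LevelFactorPositive's twisted level integrand is LevelInvariantOrbital's `orbital` of the coset
indicator, definitionally. -/
theorem levelFactor_eq_orbital (ιA : A →* G) (ιB : B →* G) (χA : A →* ℂ) (ψB : B →* ℂ) (γ₀ : G)
    (K : Subgroup G) :
    (∫ a, ∫ b, χA a * ψB b *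
        ({g | γ₀⁻¹ * g ∈ K}.indicator (fun _ => (1 : ℂ))) ((ιA a)⁻¹ * γ₀ * ιB b) ∂μB ∂μA)
      = orbital μA μB ιA ιB χA ψB ((coset γ₀ K).indicator fun _ => (1 : ℂ)) γ₀ := rfl

end Bridge

section OfLocal

variable {A B G Orb : Type*} [Group A] [Group B] [Group G]
  [TopologicalSpace A] [TopologicalSpace B] [TopologicalSpace G] [IsTopologicalGroup G]
  [CompactSpace A] [CompactSpace B]
  [MeasurableSpace A] [BorelSpace A] [SecondCountableTopology A]
  [MeasurableSpace B] [BorelSpace B] [SecondCountableTopology B]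
  (μA : Measure A) [IsFiniteMeasure μA] [μA.IsOpenPosMeasure]
  (μB : Measure B) [IsFiniteMeasure μB] [μB.IsOpenPosMeasure]

/-- **`LevelFactorData` from the local facts**: the `bv_γ₀` field is discharged by LevelFactorPositive
(`eventually_levelFactor_ne_zero`) from local constancy, the central match on the stabiliser and the open shrinking
levels; everything else is displayed. -/
noncomputable def LevelFactorData.ofLocal (ιA : A →* G) (ιB : B →* G) (hιA : Continuous ιA)
    (hιB : Continuous ιB) (χA : A →* ℂ) (ψB : B →* ℂ) (hχA : ∀ a, ‖χA a‖ = 1) (hψB : ∀ b, ‖ψB b‖ = 1)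
    (hχA' : IsLocallyConstant (χA : A → ℂ)) (hψB' : IsLocallyConstant (ψB : B → ℂ))
    (K : ℕ → Subgroup G) (hK : ∀ N, Normalizes ιB (K N)) (hKopen : ∀ N, IsOpen (K N : Set G))
    (hKanti : Antitone K) (hK1 : ∀ g, (∀ N, g ∈ K N) → g = 1) (loc : Orb → G) (γ₀ : Orb)
    (hmatch : ∀ a b, (ιA a)⁻¹ * loc γ₀ * ιB b = loc γ₀ → χA a * ψB b = 1)
    (arithS : Orb → Prop) (bS : Orb → ℂ) (bS_support : ∀ γ, bS γ ≠ 0 → arithS γ) (C : ℝ) (size : Orb → ℝ)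
    (ε : ℝ) (bS_bound : ∀ γ, arithS γ → ‖bS γ‖ ≤ C * (1 + size γ) ^ ε * ‖bS γ₀‖) (bS_γ₀ : bS γ₀ ≠ 0) :
    LevelFactorData A B G Orb μA μB where
  ιA := ιA
  ιB := ιB
  χA := χA
  ψB := ψB
  hχA := hχA
  hψB := hψB
  K := K
  hK := hK
  loc := loc
  γ₀ := γ₀
  arithS := arithS
  bS := bS
  bS_support := bS_support
  C := C
  size := size
  ε := ε
  bS_bound := bS_bound
  bS_γ₀ := bS_γ₀
  bv_γ₀ := by
    obtain ⟨N₀, h⟩ := LevelFactorPositive.eventually_levelFactor_ne_zero μA μB ιA ιB hιA hιB χA ψB hχA' hψB'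
      (loc γ₀) hmatch K hKopen hKanti hK1
    exact ⟨N₀, fun N hN => by rw [← levelFactor_eq_orbital]; exact h N hN⟩

/-- **the three `b`-fields of `KappaData` from the local facts** (`b_support ∧ b_bound ∧ b_γ₀` for the data built by
`ofLocal`): the finite-factor side of the dominance as «local data at the model». -/
theorem ofLocal_kappaData_b_fields [MeasurableMul A] [MeasurableMul B] [μA.IsMulLeftInvariant]
    [μB.IsMulLeftInvariant] (ιA : A →* G) (ιB : B →* G) (hιA : Continuous ιA)
    (hιB : Continuous ιB) (χA : A →* ℂ) (ψB : B →* ℂ) (hχA : ∀ a, ‖χA a‖ = 1) (hψB : ∀ b, ‖ψB b‖ = 1)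
    (hχA' : IsLocallyConstant (χA : A → ℂ)) (hψB' : IsLocallyConstant (ψB : B → ℂ))
    (K : ℕ → Subgroup G) (hK : ∀ N, Normalizes ιB (K N)) (hKopen : ∀ N, IsOpen (K N : Set G))
    (hKanti : Antitone K) (hK1 : ∀ g, (∀ N, g ∈ K N) → g = 1) (loc : Orb → G) (γ₀ : Orb)
    (hmatch : ∀ a b, (ιA a)⁻¹ * loc γ₀ * ιB b = loc γ₀ → χA a * ψB b = 1)
    (arithS : Orb → Prop) (bS : Orb → ℂ) (bS_support : ∀ γ, bS γ ≠ 0 → arithS γ) (C : ℝ) (size : Orb → ℝ)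
    (ε : ℝ) (bS_bound : ∀ γ, arithS γ → ‖bS γ‖ ≤ C * (1 + size γ) ^ ε * ‖bS γ₀‖) (bS_γ₀ : bS γ₀ ≠ 0) :
    let D := LevelFactorData.ofLocal μA μB ιA ιB hιA hιB χA ψB hχA hψB hχA' hψB' K hK hKopen hKanti hK1 loc γ₀
      hmatch arithS bS bS_support C size ε bS_bound bS_γ₀
    (∀ N γ, D.b N γ ≠ 0 → D.arith N γ) ∧
    (∃ Bb : ℝ, ∀ N γ, D.arith N γ → ‖D.b N γ‖ ≤ Bb * (1 + D.size γ) ^ D.ε * ‖D.b N D.γ₀‖) ∧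
    (∃ N₀ : ℕ, ∀ N ≥ N₀, D.b N D.γ₀ ≠ 0) :=
  LevelFactorData.kappaData_b_fields _

end OfLocal

end Summit.Ventures.HodgeRepro2.Tier7.Line3.LevelFactor
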